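import Summits.HodgeConjecture.HodgeConjecture.Theorems.MarkmanPartnerTransportPicardThreeK3SquaresTransportAlongCorrespondence
import Summits.HodgeConjecture.HodgeConjecture.Theorems.Ring2AbelianAllAndreTransposedInverses

/-!
# Route MarkmanPartnerTransport · crux #4 `PicardThreeK3Squares` (stmt-HodgeConjecture-19652) — HC⁴ of the square is
# an INVARIANT of the «algebraic-correspondence class» of a surface with `h^{2,0} = 1` (UNCONDITIONAL iff)

Companion of `…PicardThreeK3SquaresTransportAlongCorrespondence`: the hypothesis «some algebraic correspondence
`Φ : H²(S) → H²(S')` does not kill the period» is SYMMETRIC — a rational component `[γ₀]_*` of `Φ` with `[γ₀]_* σ ≠ 0`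
has an algebraic transpose `ᵗ[γ₀]_* : H²(S') → H²(S)` with `ᵗ[γ₀]_* σ' ≠ 0`, because
`⟨ᵗ[γ₀]_* σ', σ̄⟩_S = ⟨σ', [γ₀]_* σ̄⟩_{S'} = c̄ ⟨σ', σ̄'⟩_{S'} ≠ 0` (`[γ₀]_* σ = c σ'`, `c ≠ 0`, reality of `[γ₀]_*`,
Hodge–Riemann). Hence:

* `exists_algebraicCorrespondence_symm` — the symmetric correspondence;
* `hodgeConjectureFor_square_iff_of_algebraicCorrespondence₂` — **HC⁴(S ⊗ S) ⟺ HC⁴(S' ⊗ S')** for smooth projective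
  surfaces `S`, `S'` with `h^{2,0} = 1` related by ANY algebraic correspondence non-zero on the period — NO named fact.

THEOREMS ONLY; no sorry, no definition, no named fact; nothing here says the crux or HC is proved. Prover seat
hodge-nonav-19652-p1 (gen 16), `--supports stmt-HodgeConjecture-19652`.

References: C. Voisin, *Hodge Theory I* §6.3.2 Thm. 6.32, Lemma 11.41; W. Fulton, *Intersection Theory* §16.1;
S. Kleiman, *Dix exposés* (1968) §1.3.
-/

set_option linter.dupNamespace false

noncomputable section

namespace Summit.HodgeConjecture.HodgeConjecture.Theorems.MarkmanPartnerTransport.SquareTransport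

open scoped TensorProduct
open CategoryTheory MonoidalCategory Literature.AlgebraicGeometry Literature.AlgebraicGeometry.Motives
open Literature.AlgebraicGeometry.HodgeTheory Literature.AlgebraicTopology.SingularHomology
open Literature.AlgebraicGeometry.Motives.HodgeStructure
open Literature.AlgebraicGeometry.Surfaces
open Summit.HodgeConjecture.HodgeConjecture.Ring2.AbelianAll
open Summit.HodgeConjecture.HodgeConjecture.Theorems.OddPrimeSquares
open Summit.HodgeConjecture.HodgeConjecture.Theorems.NikulinTwinTransport
open Summit.HodgeConjecture.HodgeConjecture.Theorems.MarkmanPartnerTransport.TranscendentalPresentation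
open Summit.HodgeConjecture.HodgeConjecture.Theorems.MarkmanPartnerTransport.KugaSatakeSelf
open Summit.HodgeConjecture.HodgeConjecture.Theorems.MarkmanPartnerTransport.KugaSatakePair
open Summit.HodgeConjecture.HodgeConjecture.Theorems.MarkmanPartnerTransport.KugaSatakeMixed
open Summit.HodgeConjecture.HodgeConjecture.Theorems.MarkmanPartnerTransport.CycleInducedSector

variable {S S' : SchemeOver ℂ}

/-- `H²[hS]`: the weight-two `ℚ`-Hodge structure on `H²(S(ℂ); ℚ)` of the real Hodge model of the surface `S`. -/
local notation3 "H²[" hS "]" =>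
  bettiTwoHodgeStructure hS (BettiUniverse.realHodgeModel exists_isReal_hodgeModel_holds hS)
    (BettiUniverse.realHodgeModel_isHodgeSymmetric exists_isReal_hodgeModel_holds hS)

/-- `T[hS] = T(S)_ℚ = Hdg¹^⊥ ⊆ H²(S(ℂ); ℚ)`. -/
local notation3 "T[" hS "]" =>
  transcendentalLatticeBetti hS (BettiUniverse.realHodgeModel exists_isReal_hodgeModel_holds hS)
    (BettiUniverse.realHodgeModel_isHodgeSymmetric exists_isReal_hodgeModel_holds hS)

/-- `Θ : ℂ ⊗_ℚ H²(Y(ℂ); ℚ) → H²(Y(ℂ); ℂ)`. -/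
local notation3 "Θ[" Y "]" => ofRatClassBaseChange (Motives.ComplexPoints Y) (2 * 1)

/-- `ι : H²(Y(ℂ); ℚ) → H²(Y(ℂ); ℂ)`, the rational lattice. -/
local notation3 "ι[" Y "]" => ofRatClass (Motives.ComplexPoints Y) (2 * 1)

/-- `Transc[S, y]`: `y` is cup-orthogonal to `N¹(S) = algebraicClasses S 1`. -/
local notation3 (prettyPrint := false) "Transc[" S ", " y "]" =>
  (∀ d ∈ algebraicClasses S 1, cupProduct (rfl : 2 * 1 + 2 * 1 = 2 * 2) y d = 0)

/-! ### The symmetric correspondence -/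

/-- **An algebraic correspondence `S → S'` non-zero on the period has an algebraic companion `S' → S` non-zero on the
period** (the transpose of a rational component; Hodge–Riemann). [cite: VoisinHodgeI2002, §6.3.2 Thm. 6.32 and Lemma 11.41]
[cite: Fulton1998, §16.1] -/
theorem exists_algebraicCorrespondence_symm
    (hS : IsSmoothProjective 2 S) {σ : complexBetti S (2 * 1)} (hσ : IsOfHodgeType 2 S (2 * 1) 2 0 σ)
    (hS' : IsSmoothProjective 2 S') {σ' : complexBetti S' (2 * 1)} (hσ' : IsOfHodgeType 2 S' (2 * 1) 2 0 σ')
    (hσ'0 : σ' ≠ 0) (hline' : ∀ c : complexBetti S' (2 * 1), IsOfHodgeType 2 S' (2 * 1) 2 0 c → ∃ t : ℂ, c = t • σ')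
    (Φ : complexBetti S (2 * 1) →ₗ[ℂ] complexBetti S' (2 * 1)) (hΦ : IsAlgebraicCorrespondence 2 2 S' S Φ)
    (hΦσ : Φ σ ≠ 0) :
    ∃ Ψ : complexBetti S' (2 * 1) →ₗ[ℂ] complexBetti S (2 * 1), IsAlgebraicCorrespondence 2 2 S S' Ψ ∧ Ψ σ' ≠ 0 := by
  classical
  -- a RATIONAL algebraic component of `Φ` non-zero on `σ`
  obtain ⟨e, hab, γ, hγ, rfl⟩ := IsAlgebraicCorrespondence.exists_eq_corrAction hS' hS hΦ
  have hex : ∃ γ₀, γ₀ ∈ algebraicClasses (S' ⊗ S) e ∧ IsRationalClass γ₀ ∧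
      corrAction complexOrientationFamily hS' hS hab γ₀ σ ≠ 0 := by
    by_contra hall
    push Not at hall
    apply hΦσ
    have hγ' := (le_of_eq (supportedClasses_eq_span_isRationalClass (hS'.tensor_holds hS) (2 * e) e)) hγ
    clear hΦ hγ hΦσ
    induction hγ' using Submodule.span_induction with
    | mem γ hγQ => exact hall γ hγQ.2 hγQ.1
    | zero => rw [map_zero, LinearMap.zero_apply]
    | add γ γ' _ _ h₁ h₂ => rw [map_add, LinearMap.add_apply, h₁, h₂, add_zero]
    | smul c γ _ h₁ => rw [map_smul, LinearMap.smul_apply, h₁, smul_zero]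
  obtain ⟨γ₀, hγ₀, hγ₀Q, hγ₀σ⟩ := hex
  set Φ₀ := corrAction complexOrientationFamily hS' hS hab γ₀ with hΦ₀def
  have hΦ₀ : IsAlgebraicCorrespondence 2 2 S' S Φ₀ :=
    isAlgebraicCorrespondence_corrAction_complex hS' hS hab (by norm_num) hγ₀
  -- its transpose
  obtain ⟨Tt, hTt, hadj⟩ := IsAlgebraicCorrespondence.exists_transpose hS' hS (a := 2 * 1) (b := 2 * 1)
    (a' := 2 * 1) (b' := 2 * 1) rfl rfl hΦ₀
  refine ⟨Tt, hTt, fun h0 => ?_⟩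
  -- `Φ₀ σ = c σ'`, `c ≠ 0`; `Φ₀` is real
  have h20' : IsOfHodgeType 2 S' (2 * 1) 2 0 (Φ₀ σ) := isOfHodgeType_two_zero_of_isAlgebraicCorrespondence hS' hS hΦ₀ hσ
  obtain ⟨c, hc⟩ := hline' _ h20'
  have hc0 : c ≠ 0 := by rintro rfl; rw [zero_smul] at hc; exact hγ₀σ hc
  obtain ⟨Ψ₀, hΨ₀⟩ := exists_ratLinear_ofRatClass_eq₂ (S' := S') Φ₀
    (fun y hy => Arapura2006.isRationalClass_corrAction_complex hS' hS hab hγ₀Q hy)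
  have hconj : Φ₀ (conjClass _ (2 * 1) σ) = conjClass _ (2 * 1) (Φ₀ σ) := by
    obtain ⟨w, hw⟩ := ofRatClassBaseChange_surjective hS (2 * 1) σ
    rw [← hw, ← ofRatClassBaseChange_conj_eq hS w, ← ofRatClassBaseChange_baseChange_eq₂ hΨ₀ (HodgeStructure.conj w),
      ← ofRatClassBaseChange_baseChange_eq₂ hΨ₀ w, ← ofRatClassBaseChange_conj_eq hS' (Ψ₀.baseChange ℂ w), conj_baseChange]
  -- the adjunction at `(σ̄, σ')`: `⟨Φ₀ σ̄, σ'⟩ = ± ⟨Tt σ', σ̄⟩ = 0`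
  have key := hadj (conjClass _ (2 * 1) σ) σ'
  rw [h0, map_zero, LinearMap.zero_apply, mul_zero, hconj, hc, conjClass_smul, map_smul, LinearMap.smul_apply,
    smul_eq_mul, mul_eq_zero] at key
  rcases key with hcc | hpair
  · exact hc0 (by simpa using hcc)
  · -- Hodge–Riemann: `⟨σ̄', σ'⟩ ≠ 0`
    obtain ⟨D⟩ := nonempty_kaehlerRationalDatum hS'
    have hHR := cupPairing_conj_lefschetzPow_ne_zero hS' D (r := 0) (by norm_num) (by norm_num) hσ' hσ'0
    exact hHR hpair

/-! ### The iff -/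

/-- **HC⁴(S ⊗ S) ⟺ HC⁴(S' ⊗ S')** for smooth projective surfaces `S`, `S'` with `(2,0)`-classes the lines `ℂσ`,
`ℂσ'`, related by ANY algebraic correspondence `Φ : H²(S) → H²(S')` with `Φ σ ≠ 0` — UNCONDITIONAL (no named fact):
`hodgeConjectureFor_square_of_algebraicCorrespondence₂` in both directions (`exists_algebraicCorrespondence_symm`).
HC⁴ of the square is an invariant of the algebraic-correspondence class of a surface with `h^{2,0} = 1`.
[cite: VoisinHodgeI2002, Lemma 11.41] [cite: Zarhin1983HodgeGroupsK3, Thm. 1.5.1] [cite: Varesco2023, §2 (p. 8)] -/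
theorem hodgeConjectureFor_square_iff_of_algebraicCorrespondence₂
    (hS : IsSmoothProjective 2 S) {σ : complexBetti S (2 * 1)} (hσ : IsOfHodgeType 2 S (2 * 1) 2 0 σ) (hσ0 : σ ≠ 0)
    (hline : ∀ c : complexBetti S (2 * 1), IsOfHodgeType 2 S (2 * 1) 2 0 c → ∃ t : ℂ, c = t • σ)
    (hS' : IsSmoothProjective 2 S') {σ' : complexBetti S' (2 * 1)} (hσ' : IsOfHodgeType 2 S' (2 * 1) 2 0 σ')
    (hσ'0 : σ' ≠ 0) (hline' : ∀ c : complexBetti S' (2 * 1), IsOfHodgeType 2 S' (2 * 1) 2 0 c → ∃ t : ℂ, c = t • σ')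
    (Φ : complexBetti S (2 * 1) →ₗ[ℂ] complexBetti S' (2 * 1)) (hΦ : IsAlgebraicCorrespondence 2 2 S' S Φ)
    (hΦσ : Φ σ ≠ 0) : HodgeConjectureFor 4 (S ⊗ S) ↔ HodgeConjectureFor 4 (S' ⊗ S') := by
  refine ⟨hodgeConjectureFor_square_of_algebraicCorrespondence₂ hS hσ hσ0 hline hS' hσ' hσ'0 hline' Φ hΦ hΦσ, fun h => ?_⟩
  obtain ⟨Ψ, hΨ, hΨσ⟩ := exists_algebraicCorrespondence_symm hS hσ hS' hσ' hσ'0 hline' Φ hΦ hΦσ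
  exact hodgeConjectureFor_square_of_algebraicCorrespondence₂ hS' hσ' hσ'0 hline' hS hσ hσ0 hline Ψ hΨ hΨσ h

end Summit.HodgeConjecture.HodgeConjecture.Theorems.MarkmanPartnerTransport.SquareTransport

end
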